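import Summits.AtomisticToContinuum.FouriersLaw.Theses.ContactStieltjesMeasure

/-!
# `StieltjesRepresentation` (K2, crux stmt-AtomisticToContinuum-15248) is FALSE without its hypothesis `0 < T`

Negative lemma of the cdisprove seat (route ContactStieltjesMeasure, sub-problem FouriersLaw): the load-bearing
analysis of the hypothesis `0 < T` of the crux `Summit.AtomisticToContinuum.FouriersLaw.Theses.ContactStieltjesMeasure.
StieltjesRepresentation`.  With `0 < T` deleted (everything else verbatim) the statement fails at
`(ω₂, lam, β, γ, T, N) = (1, 1, 1, 1, 0, 2)`: weak-NESS uniqueness there is the tree's `nessUnique_proof` (stmt-0741),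
a steady family exists at positive temperatures (`pinnedChain_exists_isSteadyState`), and at `T = 0` the bath
temperatures `±δ/2` are never both positive, so the family hypothesis does not constrain `μ 2 (δ/2) (-δ/2)`; choosing a
Dirac mass with total current `2` there makes the response quotient `2/δ`, which has no limit along `𝓝[≠] 0`.
So `0 < T` is used — and only used — to keep `T ± δ/2` inside the constrained domain for small `δ`.
No statement item is closed by this file (`--supports stmt-AtomisticToContinuum-15248`).
-/

noncomputable section

namespace Summit.AtomisticToContinuum.FouriersLaw.Theorems.StieltjesRepresentation.Negative

open MeasureTheory Filter Set
open scoped Topology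
open Literature.MathematicalPhysics.KineticTheory.HeatConduction

/-- The phase point `q = (0, 1)`, `p = (-1, -1)` of the 2-site chain `pinnedChain 1 1 1 1` (`V'(r) = r + r³`)
carries the bond current `j_0 = -((p_0+p_1)/2)·V'(q_1-q_0) = V'(1) = 2`, so the Dirac mass there has total current `2`.
[folklore] -/
theorem totalCurrent_dirac_pt :
    (pinnedChain 1 1 1 1).totalCurrent
      (Measure.dirac ((fun i => ((i : ℕ) : ℝ), fun _ => (-1 : ℝ)) : PhaseSpace 2)) = 2 := by
  unfold OscillatorChain.totalCurrent
  simp only [MeasureTheory.integral_dirac]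
  unfold OscillatorChain.bondCurrent
  simp only [Fin.sum_univ_two, Fin.isValue, Fin.val_zero, Fin.val_one, pinnedChain_deriv_V]
  norm_num

/-- **`0 < T` is load-bearing.**  With `0 < T` deleted, K2 fails at `(ω₂, lam, β, γ, T, N) = (1,1,1,1,0,2)`: the
uniqueness hypothesis is the tree's `nessUnique_proof` (stmt-0741), a steady family exists at positive temperatures
(`pinnedChain_exists_isSteadyState`), and at `T = 0` the temperatures `±δ/2` are never both positive, so the family
may be a Dirac mass with current `2` there: the quotient `2/δ` has no limit along `𝓝[≠] 0`. [folklore] -/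
theorem stieltjesRepresentation_false_without_T_pos :
    ¬ (∀ ω₂ lam β : ℝ, 0 < ω₂ → 0 ≤ lam → 0 ≤ β → ∀ T : ℝ, ∃ Φ : ℕ → ℝ → ℝ, ∀ N : ℕ, 2 ≤ N →
      Monotone (Φ N) ∧ (∀ s : ℝ, s ≤ 0 → Φ N s = 0) ∧ (∃ m : ℝ, ∀ s : ℝ, Φ N s ≤ m) ∧ ∀ γ : ℝ, 0 < γ →
        (∀ (N' : ℕ) (T_L T_R : ℝ), 0 < T_L → 0 < T_R → ∀ μ ν : MeasureTheory.Measure (PhaseSpace N'),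
          (pinnedChain ω₂ lam β γ).IsSteadyState N' T_L T_R μ →
          (pinnedChain ω₂ lam β γ).IsSteadyState N' T_L T_R ν → μ = ν) →
        ∀ μ : (N' : ℕ) → ℝ → ℝ → MeasureTheory.Measure (PhaseSpace N'),
          (∀ (N' : ℕ) (T_L T_R : ℝ), 0 < T_L → 0 < T_R →
            (pinnedChain ω₂ lam β γ).IsSteadyState N' T_L T_R (μ N' T_L T_R)) →
          Filter.Tendsto (fun δ : ℝ => (pinnedChain ω₂ lam β γ).totalCurrent (μ N (T + δ / 2) (T - δ / 2)) / δ)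
            (nhdsWithin 0 {(0 : ℝ)}ᶜ)
            (nhds (((N : ℝ) - 1) * γ * ∫ t in Set.Ioi (0 : ℝ), Φ N t * (2 * t / (γ ^ 2 + t ^ 2) ^ 2)))) := by
  intro h
  classical
  obtain ⟨Φ, hΦ⟩ := h 1 1 1 one_pos zero_le_one zero_le_one 0
  obtain ⟨-, -, -, hlim⟩ := hΦ 2 le_rfl
  have hU := Summit.AtomisticToContinuum.FouriersLaw.Theorems.nessUnique_proof 1 1 1 1
    one_pos one_pos one_pos one_pos
  have hex := fun (N : ℕ) (T_L T_R : ℝ) (hL : 0 < T_L) (hR : 0 < T_R) =>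
    pinnedChain_exists_isSteadyState (ω₂ := 1) (lam := 1) (β := 1) (γ := 1)
      one_pos one_pos one_pos one_pos N hL hR
  let fam : (N : ℕ) → ℝ → ℝ → Measure (PhaseSpace N) := fun N T_L T_R =>
    if h : 0 < T_L ∧ 0 < T_R then Classical.choose (hex N T_L T_R h.1 h.2)
    else Measure.dirac ((fun i => ((i : ℕ) : ℝ), fun _ => (-1 : ℝ)) : PhaseSpace N)
  have hfam : ∀ (N : ℕ) (T_L T_R : ℝ), 0 < T_L → 0 < T_R →
      (pinnedChain 1 1 1 1).IsSteadyState N T_L T_R (fam N T_L T_R) := by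
    intro N T_L T_R hL hR
    simp only [fam, dif_pos (And.intro hL hR)]
    exact Classical.choose_spec (hex N T_L T_R hL hR)
  have hjunk : ∀ δ : ℝ, fam 2 (0 + δ / 2) (0 - δ / 2) =
      Measure.dirac ((fun i => ((i : ℕ) : ℝ), fun _ => (-1 : ℝ)) : PhaseSpace 2) := by
    intro δ
    have hneg : ¬ (0 < 0 + δ / 2 ∧ 0 < 0 - δ / 2) := by
      rintro ⟨h1, h2⟩
      linarith
    simp only [fam, dif_neg hneg]
  have hT := hlim 1 one_pos hU fam hfam
  have hfun : (fun δ : ℝ => (pinnedChain 1 1 1 1).totalCurrent (fam 2 (0 + δ / 2) (0 - δ / 2)) / δ) =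
      fun δ => 2 / δ := by
    funext δ
    rw [hjunk δ, totalCurrent_dirac_pt]
  rw [hfun] at hT
  have hid : Tendsto (fun δ : ℝ => δ) (𝓝[≠] (0 : ℝ)) (𝓝 0) :=
    tendsto_nhdsWithin_of_tendsto_nhds tendsto_id
  have hmul := hid.mul hT
  rw [zero_mul] at hmul
  have heq : (fun δ : ℝ => δ * (2 / δ)) =ᶠ[𝓝[≠] (0 : ℝ)] fun _ => (2 : ℝ) := by
    filter_upwards [self_mem_nhdsWithin] with δ hδ
    have hδ' : δ ≠ 0 := hδ
    field_simp
  have h2 : Tendsto (fun _ : ℝ => (2 : ℝ)) (𝓝[≠] (0 : ℝ)) (𝓝 0) := hmul.congr' heq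
  have h20 := tendsto_nhds_unique h2 tendsto_const_nhds
  norm_num at h20

end Summit.AtomisticToContinuum.FouriersLaw.Theorems.StieltjesRepresentation.Negative

end
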